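import Mathlib.Analysis.SpecialFunctions.Complex.LogDeriv
import Mathlib.Analysis.Calculus.IteratedDeriv.Lemmas
import Mathlib.Analysis.Calculus.Deriv.Pow
import Mathlib.Analysis.Calculus.Deriv.Inv
import HarnessLib

/-!
# Iterated derivatives of the argument along a complex-affine real line

Topic `Literature/Analysis/SpecialFunctions`.  For `a, b ∈ ℂ` the angle `t ↦ arg(a + tb)` of a point moving on a
straight line is smooth wherever `a + tb` is off the cut, and its derivatives are explicit:
`∂ₜⁱ arg(a + tb) = Im[(-1)^{i-1}(i-1)! bⁱ/(a + tb)ⁱ]` (`arg = Im log`), whence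

  **`‖∂ₜⁱ arg(a + tb)‖ ≤ (i-1)! ‖b‖ⁱ/‖a + tb‖ⁱ`**  (`norm_iteratedDeriv_arg_affine_le`).

This is the input of the line-derivative bounds of the ANGULAR sector cutoffs `ζ̃_{h,ω}(θ(k⃗))` of
Benfatto–Giuliani–Mastropietro 2006 along lines `k⃗ + t w⃗` in momentum space (`θ(k⃗) = arg(k₁ + ik₂)`, so
`a = k₁ + ik₂`, `b = w₁ + iw₂`; on the Fermi region `‖a‖` is bounded below and each derivative costs `‖w⃗‖`).

* `contDiff_const_add_mul`, `hasDerivAt_inv_affine` — the line and `t ↦ (a + tb)⁻¹` (`∂ₜ = -b(a+tb)⁻²`);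
* `iteratedDeriv_log_affine` — `∂ₜ^{j+1} log(a + tb) = (-1)ʲ j! b^{j+1} (a + tb)^{-(j+1)}` off the cut;
* `iteratedDeriv_arg_affine`, **`norm_iteratedDeriv_arg_affine_le`**; `contDiffOn_arg_affine`, `isOpen_affine_preimage_slitPlane`.

Everything is proved; no definitions, no named facts. [folklore]

## Sources

Routine calculus ("folklore"); used for G. Benfatto, A. Giuliani, V. Mastropietro, Ann. Henri Poincaré 7 (2006)
809–898, §2.5 Lemma 2.2 (`BenfattoGiulianiMastropietro2006`).
-/

noncomputable section

open Set Filter Complex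
open scoped Nat Topology

namespace Literature.Analysis.SpecialFunctions

/-- The line is smooth. [folklore] -/
theorem contDiff_const_add_mul (a b : ℂ) {n : WithTop ℕ∞} : ContDiff ℝ n (fun t : ℝ => a + (t : ℂ) * b) := by
  have h : ContDiff ℝ n (fun t : ℝ => a + Complex.ofRealCLM t * b) :=
    contDiff_const.add (Complex.ofRealCLM.contDiff.mul contDiff_const)
  simpa using h

/-- The set of parameters where the line is off the cut is open. [folklore] -/
theorem isOpen_affine_preimage_slitPlane (a b : ℂ) : IsOpen {t : ℝ | a + (t : ℂ) * b ∈ slitPlane} :=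
  isOpen_slitPlane.preimage (contDiff_const_add_mul a b (n := 0)).continuous

/-- `∂ₜ (a + tb)⁻¹ = -b ((a + tb)⁻¹)²` where `a + tb ≠ 0`. [folklore] -/
theorem hasDerivAt_inv_affine {a b : ℂ} {t : ℝ} (h : a + (t : ℂ) * b ≠ 0) :
    HasDerivAt (fun t : ℝ => (a + (t : ℂ) * b)⁻¹) (-(b * ((a + (t : ℂ) * b)⁻¹) ^ 2)) t := by
  have hline : HasDerivAt (fun t : ℝ => a + (t : ℂ) * b) b t := by
    simpa using (((hasDerivAt_id t).ofReal_comp).mul_const b).const_add a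
  have h1 := (hasDerivAt_inv h).comp t hline
  have heq : -((a + (t : ℂ) * b) ^ 2)⁻¹ * b = -(b * ((a + (t : ℂ) * b)⁻¹) ^ 2) := by rw [inv_pow]; ring
  rw [heq] at h1
  exact h1

/-- **Iterated derivatives of `log` along the line**: for `a + tb` off the cut,
`∂ₜ^{j+1} log(a + tb) = (-1)ʲ j! b^{j+1} ((a + tb)⁻¹)^{j+1}`. [folklore] -/
theorem iteratedDeriv_log_affine (a b : ℂ) (j : ℕ) {t : ℝ} (ht : a + (t : ℂ) * b ∈ slitPlane) :
    iteratedDeriv (j + 1) (fun t : ℝ => log (a + (t : ℂ) * b)) t =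
      (-1) ^ j * (j ! : ℂ) * b ^ (j + 1) * ((a + (t : ℂ) * b)⁻¹) ^ (j + 1) := by
  induction j generalizing t with
  | zero =>
    rw [zero_add, iteratedDeriv_one]
    have hline : HasDerivAt (fun t : ℝ => a + (t : ℂ) * b) b t := by
      simpa using (((hasDerivAt_id t).ofReal_comp).mul_const b).const_add a
    have h := (hline.clog_real ht).deriv
    rw [h, div_eq_mul_inv]
    simp
  | succ j ih =>
    -- the `j+1`-st derivative agrees near `t` with the closed form, whose derivative is the next closed form
    have hopen := isOpen_affine_preimage_slitPlane a b
    have hev : iteratedDeriv (j + 1) (fun t : ℝ => log (a + (t : ℂ) * b)) =ᶠ[𝓝 t]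
        fun t : ℝ => (-1) ^ j * (j ! : ℂ) * b ^ (j + 1) * ((a + (t : ℂ) * b)⁻¹) ^ (j + 1) := by
      filter_upwards [hopen.mem_nhds ht] with s hs
      exact ih hs
    rw [iteratedDeriv_succ, hev.deriv_eq]
    have hne : a + (t : ℂ) * b ≠ 0 := (mem_slitPlane_iff_arg.1 ht).2
    have hd := ((hasDerivAt_inv_affine hne).fun_pow (j + 1)).const_mul ((-1) ^ j * (j ! : ℂ) * b ^ (j + 1))
    rw [hd.deriv, Nat.add_sub_cancel, Nat.factorial_succ]
    push_cast
    ring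

/-- The argument along the line is `Im log`. [folklore] -/
theorem arg_affine_eq_im_log (a b : ℂ) :
    (fun t : ℝ => arg (a + (t : ℂ) * b)) = fun t : ℝ => (log (a + (t : ℂ) * b)).im := by
  funext t; rw [log_im]

/-- **The argument along the line is smooth off the cut.** [folklore] -/
theorem contDiffOn_arg_affine (a b : ℂ) {n : WithTop ℕ∞} :
    ContDiffOn ℝ n (fun t : ℝ => arg (a + (t : ℂ) * b)) {t : ℝ | a + (t : ℂ) * b ∈ slitPlane} := by
  intro t ht
  rw [arg_affine_eq_im_log]
  have hlog := ((Complex.contDiffAt_log (n := n) ht).restrict_scalars ℝ).comp t (contDiff_const_add_mul a b).contDiffAt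
  exact (Complex.imCLM.contDiff.contDiffAt.comp t hlog).contDiffWithinAt

/-- **Iterated derivatives of the argument along the line**:
`∂ₜ^{j+1} arg(a + tb) = Im[(-1)ʲ j! b^{j+1} ((a + tb)⁻¹)^{j+1}]` off the cut. [folklore] -/
theorem iteratedDeriv_arg_affine (a b : ℂ) (j : ℕ) {t : ℝ} (ht : a + (t : ℂ) * b ∈ slitPlane) :
    iteratedDeriv (j + 1) (fun t : ℝ => arg (a + (t : ℂ) * b)) t =
      ((-1) ^ j * (j ! : ℂ) * b ^ (j + 1) * ((a + (t : ℂ) * b)⁻¹) ^ (j + 1)).im := by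
  rw [arg_affine_eq_im_log]
  -- `Im` commutes with the iterated derivative near `t` (where `log` of the line is smooth)
  have hopen := isOpen_affine_preimage_slitPlane a b
  have key : ∀ (i : ℕ) (s : ℝ), a + (s : ℂ) * b ∈ slitPlane →
      iteratedDeriv i (fun t : ℝ => (log (a + (t : ℂ) * b)).im) s =
        (iteratedDeriv i (fun t : ℝ => log (a + (t : ℂ) * b)) s).im := by
    intro i
    induction i with
    | zero => intro s _; simp
    | succ i ih =>
      intro s hs
      have hev : iteratedDeriv i (fun t : ℝ => (log (a + (t : ℂ) * b)).im) =ᶠ[𝓝 s]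
          fun t : ℝ => (iteratedDeriv i (fun t : ℝ => log (a + (t : ℂ) * b)) t).im := by
        filter_upwards [hopen.mem_nhds hs] with s' hs'
        exact ih s' hs'
      rw [iteratedDeriv_succ, hev.deriv_eq, iteratedDeriv_succ]
      -- the `i`-th derivative of `log` of the line is differentiable at `s`
      have hdiff : DifferentiableAt ℝ (iteratedDeriv i (fun t : ℝ => log (a + (t : ℂ) * b))) s := by
        have hlog : ContDiffAt ℝ ((1 : WithTop ℕ∞) + i) (log ∘ fun t : ℝ => a + (t : ℂ) * b) s :=
          ((Complex.contDiffAt_log hs).restrict_scalars ℝ).comp s (contDiff_const_add_mul a b).contDiffAt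
        have hF : DifferentiableAt ℝ (iteratedFDeriv ℝ i (fun t : ℝ => log (a + (t : ℂ) * b))) s :=
          (hlog.iteratedFDeriv_right le_rfl).differentiableAt one_ne_zero
        rw [iteratedDeriv_eq_equiv_comp]
        exact (ContinuousMultilinearMap.piFieldEquiv ℝ (Fin i) ℂ).symm.toContinuousLinearEquiv.differentiableAt.comp s hF
      have h := (Complex.imCLM.hasFDerivAt.comp_hasDerivAt s hdiff.hasDerivAt).deriv
      simpa [Function.comp_def] using h
  rw [key (j + 1) t ht, iteratedDeriv_log_affine a b j ht]

/-- **The derivative bound**: `‖∂ₜ^{j+1} arg(a + tb)‖ ≤ j! ‖b‖^{j+1} / ‖a + tb‖^{j+1}` off the cut. [folklore] -/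
theorem norm_iteratedDeriv_arg_affine_le (a b : ℂ) (j : ℕ) {t : ℝ} (ht : a + (t : ℂ) * b ∈ slitPlane) :
    ‖iteratedDeriv (j + 1) (fun t : ℝ => arg (a + (t : ℂ) * b)) t‖ ≤
      (j ! : ℝ) * ‖b‖ ^ (j + 1) / ‖a + (t : ℂ) * b‖ ^ (j + 1) := by
  rw [iteratedDeriv_arg_affine a b j ht, Real.norm_eq_abs]
  refine (abs_im_le_norm _).trans (le_of_eq ?_)
  simp only [norm_mul, norm_pow, norm_inv, norm_neg, norm_one, one_pow, one_mul, Complex.norm_natCast, inv_pow,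
    div_eq_mul_inv]

end Literature.Analysis.SpecialFunctions
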